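import Mathlib
import HarnessLib
import Summits.HubbardSuperconductivity.HubbardSuperconductivity.Theorems.KLProgrammeKLRegimeEngineLastStepResponseInputs

/-!
# K3 gen-8-FLOW (stmt 20437, stub (C), located item #20, cure (δ′) «LAST-STEP SWAP», layer F3c″): the tangential jets of `t` with the SHARP graded
# curve table `(D₁, D₂, D·4^m, D·16^m)` and the datum-`1` Bell rows — the constants that enter the threshold cubed, kept at their natural size

Cell gate-hubbard-kl, seat p2 g17.  `…ResponseInputsGraded` books all four curve jets against one `D` (`≈ 10¹⁴`, the order-4 numerics), which puts `D⁴` into the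
tangential constant `Zt` and `Zt³` into the threshold.  Here the low orders keep their own sizes (`D₁ = klCurveD1 ≤ 231`, `D₂ = klCurveD2 ≤ 7·10⁵`): with
`P₄ := D₁⁴ + 6D₁²D₂ + 3D₂² + 4D₁D + D` (every Bell row of the table `(D₁, D₂, D·l, D·l²)` against weights `lʲ` is `≤ P₄·lⁱ`), the tangential jets hold with
`Zt ≥ 128·Gm·P₄`, and the datum-`1` Bell rows `PP_a` (moments `≡ 1`) are the explicit Bell polynomials of the curve table, of size `≤ P₄·lʲ`.

* §1 `tjetRowS_*`, **`lastResponse_tjets_of_pieceJets_sharp`** (`|t| ≤ Zt·U/4^m`, `|t⁽ⁱ⁾| ≤ (Zt·U/4^m)·4^{im}`, `Zt ≥ 128·Gm·P₄`);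
* §2 **`datumOne_bellRows_sharp`** — the explicit `PP_a` rows and their sizes `≤ P₄·lʲ`.

Proofs only; no definitions; nothing asserts superconductivity.  Refs: BGM 2006 §2.4 (2.36)–(2.42) [cite: BenfattoGiulianiMastropietro2006].
-/

noncomputable section

namespace Summit.HubbardSuperconductivity.HubbardSuperconductivity.Theorems.EngineV8

set_option linter.dupNamespace false -- summit = problem name (single-conjunct summit), D-0017

open Real Finset Literature.MathematicalPhysics.QuantumLattice Literature.Probability.LatticeModels
open Summit.HubbardSuperconductivity.HubbardSuperconductivity.Theorems.KLRegimeSplit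
open Summit.HubbardSuperconductivity.HubbardSuperconductivity.Theorems.DispersionFlow
open Summit.HubbardSuperconductivity.HubbardSuperconductivity.Theorems.KLProgrammeLegKernels
open Summit.HubbardSuperconductivity.HubbardSuperconductivity.Theorems.PerturbedFermiCurve

variable {L M : ℕ} [NeZero L]

/-! ## §1 The sharp rows and the tangential jets -/

section RowsSharp

variable {l li U Z Gm D₁ D₂ D : ℝ} (hli1 : li * l ^ 2 = 1) (hl1 : 1 ≤ l) (hU0 : 0 < U) (hU1 : U ≤ 1) (hGm : 0 ≤ Gm)
  (hD₁ : 1 ≤ D₁) (hD₂ : 1 ≤ D₂) (hD : 1 ≤ D) (hZ : 128 * Gm * (D₁ ^ 4 + 6 * D₁ ^ 2 * D₂ + 3 * D₂ ^ 2 + 4 * D₁ * D + D) ≤ Z)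
include hli1 hl1 hU0 hU1 hGm hD₁ hD₂ hD hZ

omit hli1 hD₁ hD₂ hD in
/-- The closing step: `c ≤ P₄` ⇒ `128·(c·Gm·U²·lⁿ) ≤ Z·U·lⁿ`. -/
theorem tjetRowS_fin {c : ℝ} (n : ℕ) (hc0 : 0 ≤ c) (hc : c ≤ D₁ ^ 4 + 6 * D₁ ^ 2 * D₂ + 3 * D₂ ^ 2 + 4 * D₁ * D + D) :
    128 * (c * Gm * U ^ 2 * l ^ n) ≤ Z * U * l ^ n := by
  have hU2 : U ^ 2 ≤ U := by nlinarith
  have hl0 : 0 ≤ l := by linarith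
  have h1 : 128 * (c * Gm) ≤ Z := by nlinarith [mul_le_mul_of_nonneg_right hc hGm]
  have hZ0 : 0 ≤ Z := le_trans (by positivity) h1
  calc 128 * (c * Gm * U ^ 2 * l ^ n) = (128 * (c * Gm)) * (U ^ 2 * l ^ n) := by ring
    _ ≤ Z * (U ^ 2 * l ^ n) := mul_le_mul_of_nonneg_right h1 (by positivity)
    _ ≤ Z * (U * l ^ n) := mul_le_mul_of_nonneg_left (mul_le_mul_of_nonneg_right hU2 (by positivity)) hZ0
    _ = Z * U * l ^ n := by ring

/-- Row `i = 1` (`M j = Gm·U²·lʲ·l⁻²`, curve table `(D₁, D₂, D·l, D·l²)`). -/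
theorem tjetRowS_one : 128 * (Gm * U ^ 2 * l ^ 1 * li * D₁) * l ^ 2 ≤ Z * U * l ^ 1 := by
  have e : 128 * (Gm * U ^ 2 * l ^ 1 * li * D₁) * l ^ 2 = 128 * (D₁ * Gm * U ^ 2 * l ^ 1) := by
    linear_combination (128 * (D₁ * Gm * U ^ 2 * l ^ 1)) * hli1
  rw [e]
  refine tjetRowS_fin hl1 hU0 hU1 hGm hZ 1 (by linarith) ?_
  have a : D₁ ≤ D₁ ^ 4 := by nlinarith [one_le_pow₀ (n := 3) hD₁]
  nlinarith [mul_nonneg (mul_nonneg (by norm_num : (0 : ℝ) ≤ 6) (sq_nonneg D₁)) (zero_le_one.trans hD₂), sq_nonneg D₂,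
    mul_nonneg (zero_le_one.trans hD₁) (zero_le_one.trans hD)]

/-- Row `i = 2`. -/
theorem tjetRowS_two : 128 * (Gm * U ^ 2 * l ^ 2 * li * D₁ ^ 2 + Gm * U ^ 2 * l ^ 1 * li * D₂) * l ^ 2 ≤ Z * U * l ^ 2 := by
  have e : 128 * (Gm * U ^ 2 * l ^ 2 * li * D₁ ^ 2 + Gm * U ^ 2 * l ^ 1 * li * D₂) * l ^ 2 = 128 * ((D₁ ^ 2 * l ^ 2 + D₂ * l) * Gm * U ^ 2) := by
    linear_combination (128 * ((D₁ ^ 2 * l ^ 2 + D₂ * l) * Gm * U ^ 2)) * hli1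
  rw [e]
  have hbr : D₁ ^ 2 * l ^ 2 + D₂ * l ≤ (D₁ ^ 2 + D₂) * l ^ 2 := by
    have c : l ≤ l ^ 2 := by nlinarith
    nlinarith [mul_le_mul_of_nonneg_left c (zero_le_one.trans hD₂)]
  calc 128 * ((D₁ ^ 2 * l ^ 2 + D₂ * l) * Gm * U ^ 2) ≤ 128 * ((D₁ ^ 2 + D₂) * Gm * U ^ 2 * l ^ 2) := by
        nlinarith [mul_le_mul_of_nonneg_right hbr (by positivity : 0 ≤ Gm * U ^ 2)]
    _ ≤ Z * U * l ^ 2 := by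
        refine tjetRowS_fin hl1 hU0 hU1 hGm hZ 2 (by positivity) ?_
        have a : D₁ ^ 2 ≤ D₁ ^ 4 := pow_le_pow_right₀ hD₁ (by norm_num)
        nlinarith [mul_nonneg (mul_nonneg (by norm_num : (0 : ℝ) ≤ 6) (sq_nonneg D₁)) (zero_le_one.trans hD₂),
          mul_nonneg (zero_le_one.trans hD₁) (zero_le_one.trans hD)]

/-- Row `i = 3`. -/
theorem tjetRowS_three : 128 * (Gm * U ^ 2 * l ^ 3 * li * D₁ ^ 3 + 3 * (Gm * U ^ 2 * l ^ 2 * li) * D₁ * D₂ + Gm * U ^ 2 * l ^ 1 * li * (D * l)) * l ^ 2 ≤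
    Z * U * l ^ 3 := by
  have e : 128 * (Gm * U ^ 2 * l ^ 3 * li * D₁ ^ 3 + 3 * (Gm * U ^ 2 * l ^ 2 * li) * D₁ * D₂ + Gm * U ^ 2 * l ^ 1 * li * (D * l)) * l ^ 2 =
      128 * ((D₁ ^ 3 * l ^ 3 + 3 * D₁ * D₂ * l ^ 2 + D * l ^ 2) * Gm * U ^ 2) := by
    linear_combination (128 * ((D₁ ^ 3 * l ^ 3 + 3 * D₁ * D₂ * l ^ 2 + D * l ^ 2) * Gm * U ^ 2)) * hli1
  rw [e]
  have hbr : D₁ ^ 3 * l ^ 3 + 3 * D₁ * D₂ * l ^ 2 + D * l ^ 2 ≤ (D₁ ^ 3 + 3 * D₁ * D₂ + D) * l ^ 3 := by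
    have c : l ^ 2 ≤ l ^ 3 := pow_le_pow_right₀ hl1 (by norm_num)
    have a1 : 0 ≤ 3 * D₁ * D₂ := by nlinarith
    nlinarith [mul_le_mul_of_nonneg_left c a1, mul_le_mul_of_nonneg_left c (zero_le_one.trans hD)]
  calc 128 * ((D₁ ^ 3 * l ^ 3 + 3 * D₁ * D₂ * l ^ 2 + D * l ^ 2) * Gm * U ^ 2) ≤ 128 * ((D₁ ^ 3 + 3 * D₁ * D₂ + D) * Gm * U ^ 2 * l ^ 3) := by
        nlinarith [mul_le_mul_of_nonneg_right hbr (by positivity : 0 ≤ Gm * U ^ 2)]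
    _ ≤ Z * U * l ^ 3 := by
        refine tjetRowS_fin hl1 hU0 hU1 hGm hZ 3 (by nlinarith) ?_
        have a : D₁ ^ 3 ≤ D₁ ^ 4 := pow_le_pow_right₀ hD₁ (by norm_num)
        have b : 3 * D₁ * D₂ ≤ 6 * D₁ ^ 2 * D₂ := by nlinarith [mul_nonneg (zero_le_one.trans hD₁) (zero_le_one.trans hD₂)]
        nlinarith [sq_nonneg D₂, mul_nonneg (zero_le_one.trans hD₁) (zero_le_one.trans hD)]

/-- Row `i = 4`. -/
theorem tjetRowS_four : 128 * (Gm * U ^ 2 * l ^ 4 * li * D₁ ^ 4 + 6 * (Gm * U ^ 2 * l ^ 3 * li) * D₁ ^ 2 * D₂ + 3 * (Gm * U ^ 2 * l ^ 2 * li) * D₂ ^ 2 +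
      4 * (Gm * U ^ 2 * l ^ 2 * li) * D₁ * (D * l) + Gm * U ^ 2 * l ^ 1 * li * (D * l ^ 2)) * l ^ 2 ≤ Z * U * l ^ 4 := by
  have e : 128 * (Gm * U ^ 2 * l ^ 4 * li * D₁ ^ 4 + 6 * (Gm * U ^ 2 * l ^ 3 * li) * D₁ ^ 2 * D₂ + 3 * (Gm * U ^ 2 * l ^ 2 * li) * D₂ ^ 2 +
        4 * (Gm * U ^ 2 * l ^ 2 * li) * D₁ * (D * l) + Gm * U ^ 2 * l ^ 1 * li * (D * l ^ 2)) * l ^ 2 =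
      128 * ((D₁ ^ 4 * l ^ 4 + 6 * D₁ ^ 2 * D₂ * l ^ 3 + 3 * D₂ ^ 2 * l ^ 2 + 4 * D₁ * D * l ^ 3 + D * l ^ 3) * Gm * U ^ 2) := by
    linear_combination (128 * ((D₁ ^ 4 * l ^ 4 + 6 * D₁ ^ 2 * D₂ * l ^ 3 + 3 * D₂ ^ 2 * l ^ 2 + 4 * D₁ * D * l ^ 3 + D * l ^ 3) * Gm * U ^ 2)) * hli1
  rw [e]
  have hbr : D₁ ^ 4 * l ^ 4 + 6 * D₁ ^ 2 * D₂ * l ^ 3 + 3 * D₂ ^ 2 * l ^ 2 + 4 * D₁ * D * l ^ 3 + D * l ^ 3 ≤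
      (D₁ ^ 4 + 6 * D₁ ^ 2 * D₂ + 3 * D₂ ^ 2 + 4 * D₁ * D + D) * l ^ 4 := by
    have c : l ^ 3 ≤ l ^ 4 := pow_le_pow_right₀ hl1 (by norm_num)
    have c' : l ^ 2 ≤ l ^ 4 := pow_le_pow_right₀ hl1 (by norm_num)
    have a1 : 0 ≤ 6 * D₁ ^ 2 * D₂ := by nlinarith [sq_nonneg D₁]
    have a2 : 0 ≤ 3 * D₂ ^ 2 := by positivity
    have a3 : 0 ≤ 4 * D₁ * D := by nlinarith
    nlinarith [mul_le_mul_of_nonneg_left c a1, mul_le_mul_of_nonneg_left c' a2, mul_le_mul_of_nonneg_left c a3,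
      mul_le_mul_of_nonneg_left c (zero_le_one.trans hD)]
  calc 128 * ((D₁ ^ 4 * l ^ 4 + 6 * D₁ ^ 2 * D₂ * l ^ 3 + 3 * D₂ ^ 2 * l ^ 2 + 4 * D₁ * D * l ^ 3 + D * l ^ 3) * Gm * U ^ 2)
      ≤ 128 * ((D₁ ^ 4 + 6 * D₁ ^ 2 * D₂ + 3 * D₂ ^ 2 + 4 * D₁ * D + D) * Gm * U ^ 2 * l ^ 4) := by
        nlinarith [mul_le_mul_of_nonneg_right hbr (by positivity : 0 ≤ Gm * U ^ 2)]
    _ ≤ Z * U * l ^ 4 := tjetRowS_fin hl1 hU0 hU1 hGm hZ 4 (by positivity) le_rfl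

end RowsSharp

section TJetsSharp

variable {β : ℝ} (hβ : 0 < β) {m : ℕ} (hN : nScales β < m + 1) {U : ℝ} (hU0 : 0 < U) (hU1 : U ≤ 1) (Ko P : TrigPolyC4v)
  {G : ℕ → ℝ} {Gm : ℝ} (hG0 : ∀ j ≤ 4, 0 ≤ G j) (hGm : ∀ j ≤ 4, G j ≤ Gm)
  (hPJ : ∀ j ≤ 4, ∀ q : Momentum, ‖iteratedFDeriv ℝ j (evalM P) q‖ ≤ G j * uPow j U * (4 : ℝ) ^ (((j : ℤ) - 2) * m))
  {γ : ℝ → Momentum} (hγ : ContDiff ℝ 4 γ) {Dc : ℕ → ℝ} (hDc : ∀ θ : ℝ, ∀ i, 1 ≤ i → i ≤ 4 → ‖iteratedDeriv i γ θ‖ ≤ Dc i)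
  {D₁ D₂ D : ℝ} (hD₁ : 1 ≤ D₁) (hD₂ : 1 ≤ D₂) (hD : 1 ≤ D) (hDc1 : Dc 1 ≤ D₁) (hDc2 : Dc 2 ≤ D₂) (hDc3 : Dc 3 ≤ D * (4 : ℝ) ^ m)
  (hDc4 : Dc 4 ≤ D * ((4 : ℝ) ^ m) ^ 2)
include hβ hN hU0 hU1 hG0 hGm hPJ hγ hDc hD₁ hD₂ hD hDc1 hDc2 hDc3 hDc4

/-- **THE TANGENTIAL JETS OF `t`, SHARP TABLE**: with `‖γ′‖ ≤ D₁`, `‖γ″‖ ≤ D₂`, `‖γ‴‖ ≤ D·4^m`, `‖γ⁗‖ ≤ D·16^m` (`1 ≤ D₁, D₂, D`) and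
`Zt ≥ 128·Gm·(D₁⁴ + 6D₁²D₂ + 3D₂² + 4D₁D + D)`: `|t(θ)| ≤ Zt·U/4^m`, `|t⁽ⁱ⁾(θ)| ≤ (Zt·U/4^m)·(4^m)ⁱ` (`1 ≤ i ≤ 4`). -/
theorem lastResponse_tjets_of_pieceJets_sharp {Zt : ℝ} (hZ : 128 * Gm * (D₁ ^ 4 + 6 * D₁ ^ 2 * D₂ + 3 * D₂ ^ 2 + 4 * D₁ * D + D) ≤ Zt) :
    (∀ θ : ℝ, |(fun θ' : ℝ => evalM (fsub (fsub Ko P) Ko) (γ θ') / (Real.pi / β)) θ| ≤ Zt * U / (4 : ℝ) ^ m) ∧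
    (∀ θ : ℝ, ∀ i, 1 ≤ i → i ≤ 4 →
      |iteratedDeriv i (fun θ' : ℝ => evalM (fsub (fsub Ko P) Ko) (γ θ') / (Real.pi / β)) θ| ≤ (Zt * U / (4 : ℝ) ^ m) * ((4 : ℝ) ^ m) ^ i) := by
  have hπ := Real.pi_pos
  set l : ℝ := (4 : ℝ) ^ m with hl
  have hl1 : 1 ≤ l := one_le_pow₀ (by norm_num)
  have hl0 : 0 < l := by positivity
  have hGm0 : 0 ≤ Gm := (hG0 0 (by norm_num)).trans (hGm 0 (by norm_num))
  have hP4 : 1 ≤ D₁ ^ 4 + 6 * D₁ ^ 2 * D₂ + 3 * D₂ ^ 2 + 4 * D₁ * D + D := by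
    nlinarith [one_le_pow₀ (n := 4) hD₁, sq_nonneg D₁, sq_nonneg D₂, mul_nonneg (zero_le_one.trans hD₁) (zero_le_one.trans hD),
      mul_nonneg (sq_nonneg D₁) (zero_le_one.trans hD₂)]
  -- the price of `1/ω₀`: `β/π ≤ 32·4^{m+1} = 128·l`
  have hinv : β / Real.pi ≤ 128 * l := by
    have := beta_div_pi_le_of_nScales_lt hβ hN; rw [pow_succ] at this; linarith
  have ht : (fun θ' : ℝ => evalM (fsub (fsub Ko P) Ko) (γ θ') / (Real.pi / β)) = fun θ' => (-(β / Real.pi)) * (evalM P ∘ γ) θ' := by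
    funext θ'; simp only [Function.comp_apply, evalM_fsub]; field_simp; ring
  have hF : ContDiff ℝ 4 (evalM P) := contDiff_evalM P
  have hcomp : ContDiff ℝ 4 (evalM P ∘ γ) := hF.comp hγ
  have hzl : ∀ j : ℕ, (4 : ℝ) ^ (((j : ℤ) - 2) * m) = l ^ j / l ^ 2 := fun j => by
    rw [eq_div_iff (by positivity), hl]; exact four_zpow_sub_two_mul_mul_sq j m
  refine ⟨fun θ => ?_, fun θ i hi1 hi4 => ?_⟩
  · rw [ht]
    simp only [Function.comp_apply, abs_mul, abs_neg, abs_of_pos (div_pos hβ hπ)]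
    have h0 := hPJ 0 (by norm_num) (γ θ)
    rw [hzl 0, norm_iteratedFDeriv_zero, Real.norm_eq_abs, pow_zero, uPow_zero, abs_of_pos hU0] at h0
    have hG0m : G 0 ≤ Gm := hGm 0 (by norm_num)
    have hZ' : 128 * Gm ≤ Zt := by
      have : Gm ≤ Gm * (D₁ ^ 4 + 6 * D₁ ^ 2 * D₂ + 3 * D₂ ^ 2 + 4 * D₁ * D + D) := by nlinarith
      linarith
    calc β / Real.pi * |evalM P (γ θ)| ≤ (128 * l) * (G 0 * U * (1 / l ^ 2)) :=
          mul_le_mul hinv h0 (abs_nonneg _) (by positivity)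
      _ = (128 * G 0) * U / l := by field_simp
      _ ≤ (128 * Gm) * U / l := by gcongr
      _ ≤ Zt * U / l := by gcongr
  · have hk' : ((i : ℕ) : WithTop ℕ∞) ≤ 4 := by exact_mod_cast hi4
    rw [ht, iteratedDeriv_const_mul _ (hcomp.contDiffAt.of_le hk'), abs_mul, abs_neg, abs_of_pos (div_pos hβ hπ)]
    set li : ℝ := (l ^ 2)⁻¹ with hli
    have hli1 : li * l ^ 2 = 1 := inv_mul_cancel₀ (by positivity)
    have hli0 : 0 < li := by positivity
    have hM : ∀ j, 1 ≤ j → j ≤ 4 → ‖iteratedFDeriv ℝ j (evalM P) (γ θ)‖ ≤ Gm * U ^ 2 * l ^ j * li := by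
      intro j hj1 hj4
      have h := hPJ j hj4 (γ θ)
      have hu : uPow j U = U ^ 2 := by unfold uPow; rw [if_neg (by omega)]
      rw [hzl j, hu, div_eq_mul_inv, ← mul_assoc] at h
      exact h.trans (by gcongr; exact hGm j hj4)
    have hDc' : ∀ i, 1 ≤ i → i ≤ 4 → ‖iteratedDeriv i γ θ‖ ≤ (fun i => if i = 1 then D₁ else if i = 2 then D₂ else if i = 3 then D * l else D * l ^ 2) i := by
      intro i hi1 hi4
      interval_cases i
      · exact (hDc θ 1 le_rfl (by norm_num)).trans hDc1
      · exact (hDc θ 2 (by norm_num) (by norm_num)).trans hDc2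
      · exact (hDc θ 3 (by norm_num) (by norm_num)).trans hDc3
      · exact (hDc θ 4 (by norm_num) le_rfl).trans hDc4
    obtain ⟨hb1, hb2, hb3, hb4⟩ := abs_iteratedDeriv_comp_le_bell (F := evalM P) hF hγ (M := fun j => Gm * U ^ 2 * l ^ j * li)
      (D := fun i => if i = 1 then D₁ else if i = 2 then D₂ else if i = 3 then D * l else D * l ^ 2) hM hDc'
    simp only [show (1 : ℕ) ≠ 2 by norm_num, show (1 : ℕ) ≠ 3 by norm_num, show (2 : ℕ) ≠ 1 by norm_num, show (2 : ℕ) ≠ 3 by norm_num,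
      show (3 : ℕ) ≠ 1 by norm_num, show (3 : ℕ) ≠ 2 by norm_num, show (4 : ℕ) ≠ 1 by norm_num, show (4 : ℕ) ≠ 2 by norm_num,
      show (4 : ℕ) ≠ 3 by norm_num, if_true, if_false] at hb1 hb2 hb3 hb4
    have goal_of : ∀ {X B : ℝ}, |X| ≤ B → 128 * B * l ^ 2 ≤ Zt * U * l ^ i → β / Real.pi * |X| ≤ Zt * U / l * l ^ i := by
      intro X B hX hB
      calc β / Real.pi * |X| ≤ (128 * l) * B := mul_le_mul hinv hX (abs_nonneg _) (by positivity)
        _ = (128 * B * l ^ 2) / l := by rw [eq_div_iff hl0.ne']; ring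
        _ ≤ (Zt * U * l ^ i) / l := div_le_div_of_nonneg_right hB hl0.le
        _ = Zt * U / l * l ^ i := by ring
    interval_cases i
    · exact goal_of hb1 (tjetRowS_one hli1 hl1 hU0 hU1 hGm0 hD₁ hD₂ hD hZ)
    · exact goal_of hb2 (tjetRowS_two hli1 hl1 hU0 hU1 hGm0 hD₁ hD₂ hD hZ)
    · exact goal_of hb3 (tjetRowS_three hli1 hl1 hU0 hU1 hGm0 hD₁ hD₂ hD hZ)
    · exact goal_of hb4 (tjetRowS_four hli1 hl1 hU0 hU1 hGm0 hD₁ hD₂ hD hZ)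

end TJetsSharp

/-! ## §2 The datum-`1` Bell rows against a graded curve table -/

omit [NeZero L] in
/-- **The datum-`1` rows**: with `PP_a j :=` the Bell polynomial of `(Dc, 1)`, the structural rows hold with equality, and if `Dc 1 ≤ D₁`, `Dc 2 ≤ D₂`,
`Dc 3 ≤ D·l`, `Dc 4 ≤ D·l²` (`1 ≤ D₁, D₂, D, l`; `0 ≤ Dc`) then `PP_a j ≤ P₄·lʲ`, `P₄ = D₁⁴ + 6D₁²D₂ + 3D₂² + 4D₁D + D`. -/
theorem datumOne_bellRows_sharp {Dc : ℕ → ℝ} {D₁ D₂ D l : ℝ} (hl1 : 1 ≤ l) (hD₁ : 1 ≤ D₁) (hD₂ : 1 ≤ D₂) (hD : 1 ≤ D)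
    (hDc0 : ∀ i, 1 ≤ i → i ≤ 4 → 0 ≤ Dc i) (hDc1 : Dc 1 ≤ D₁) (hDc2 : Dc 2 ≤ D₂) (hDc3 : Dc 3 ≤ D * l) (hDc4 : Dc 4 ≤ D * l ^ 2) :
    ∀ j ≤ 4, (fun j : ℕ => if j = 0 then (1 : ℝ) else if j = 1 then Dc 1 else if j = 2 then Dc 1 ^ 2 + Dc 2
      else if j = 3 then Dc 1 ^ 3 + 3 * Dc 1 * Dc 2 + Dc 3 else Dc 1 ^ 4 + 6 * Dc 1 ^ 2 * Dc 2 + 3 * Dc 2 ^ 2 + 4 * Dc 1 * Dc 3 + Dc 4) j ≤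
      (D₁ ^ 4 + 6 * D₁ ^ 2 * D₂ + 3 * D₂ ^ 2 + 4 * D₁ * D + D) * l ^ j := by
  have d1 := hDc0 1 le_rfl (by norm_num); have d2 := hDc0 2 (by norm_num) (by norm_num)
  have d3 := hDc0 3 (by norm_num) (by norm_num); have d4 := hDc0 4 (by norm_num) le_rfl
  have hD₁0 : 0 ≤ D₁ := zero_le_one.trans hD₁
  have hD₂0 : 0 ≤ D₂ := zero_le_one.trans hD₂
  have hD0 : 0 ≤ D := zero_le_one.trans hD
  have hl0 : 0 ≤ l := zero_le_one.trans hl1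
  have hP4 : 1 ≤ D₁ ^ 4 + 6 * D₁ ^ 2 * D₂ + 3 * D₂ ^ 2 + 4 * D₁ * D + D := by
    nlinarith [one_le_pow₀ (n := 4) hD₁, mul_nonneg (sq_nonneg D₁) hD₂0, sq_nonneg D₂, mul_nonneg hD₁0 hD0]
  have hP40 : 0 ≤ D₁ ^ 4 + 6 * D₁ ^ 2 * D₂ + 3 * D₂ ^ 2 + 4 * D₁ * D + D := zero_le_one.trans hP4
  have e1 : Dc 1 ≤ D₁ ^ 4 + 6 * D₁ ^ 2 * D₂ + 3 * D₂ ^ 2 + 4 * D₁ * D + D := by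
    have : D₁ ≤ D₁ ^ 4 := by nlinarith [one_le_pow₀ (n := 3) hD₁]
    nlinarith [mul_nonneg (sq_nonneg D₁) hD₂0, sq_nonneg D₂, mul_nonneg hD₁0 hD0]
  have e2 : Dc 1 ^ 2 + Dc 2 ≤ D₁ ^ 4 + 6 * D₁ ^ 2 * D₂ + 3 * D₂ ^ 2 + 4 * D₁ * D + D := by
    have a : Dc 1 ^ 2 ≤ D₁ ^ 2 := pow_le_pow_left₀ d1 hDc1 2
    have b : D₁ ^ 2 ≤ D₁ ^ 4 := pow_le_pow_right₀ hD₁ (by norm_num)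
    have c : D₂ ≤ 3 * D₂ ^ 2 := by nlinarith
    nlinarith [mul_nonneg (sq_nonneg D₁) hD₂0, mul_nonneg hD₁0 hD0]
  have e3 : Dc 1 ^ 3 + 3 * Dc 1 * Dc 2 + Dc 3 ≤ (D₁ ^ 4 + 6 * D₁ ^ 2 * D₂ + 3 * D₂ ^ 2 + 4 * D₁ * D + D) * l := by
    have a : Dc 1 ^ 3 ≤ D₁ ^ 3 := pow_le_pow_left₀ d1 hDc1 3
    have a' : D₁ ^ 3 ≤ D₁ ^ 4 := pow_le_pow_right₀ hD₁ (by norm_num)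
    have b : 3 * Dc 1 * Dc 2 ≤ 3 * D₁ * D₂ := by nlinarith [mul_le_mul hDc1 hDc2 d2 hD₁0]
    have b' : 3 * D₁ * D₂ ≤ 6 * D₁ ^ 2 * D₂ := by nlinarith [mul_nonneg hD₁0 hD₂0]
    have s : Dc 1 ^ 3 + 3 * Dc 1 * Dc 2 + Dc 3 ≤ (D₁ ^ 4 + 6 * D₁ ^ 2 * D₂) + D * l := by linarith
    nlinarith [mul_le_mul_of_nonneg_left hl1 (by positivity : 0 ≤ D₁ ^ 4 + 6 * D₁ ^ 2 * D₂), sq_nonneg D₂, mul_nonneg hD₁0 hD0,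
      mul_nonneg (mul_nonneg hD₁0 hD0) hl0]
  have e4 : Dc 1 ^ 4 + 6 * Dc 1 ^ 2 * Dc 2 + 3 * Dc 2 ^ 2 + 4 * Dc 1 * Dc 3 + Dc 4 ≤ (D₁ ^ 4 + 6 * D₁ ^ 2 * D₂ + 3 * D₂ ^ 2 + 4 * D₁ * D + D) * l ^ 2 := by
    have a : Dc 1 ^ 4 ≤ D₁ ^ 4 := pow_le_pow_left₀ d1 hDc1 4
    have b : 6 * Dc 1 ^ 2 * Dc 2 ≤ 6 * D₁ ^ 2 * D₂ := by nlinarith [mul_le_mul (pow_le_pow_left₀ d1 hDc1 2) hDc2 d2 (sq_nonneg D₁)]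
    have c : 3 * Dc 2 ^ 2 ≤ 3 * D₂ ^ 2 := by nlinarith [pow_le_pow_left₀ d2 hDc2 2]
    have d : 4 * Dc 1 * Dc 3 ≤ 4 * D₁ * D * l := by nlinarith [mul_le_mul hDc1 hDc3 d3 hD₁0]
    have hl2 : l ≤ l ^ 2 := by nlinarith
    have hl2' : 1 ≤ l ^ 2 := one_le_pow₀ hl1
    nlinarith [mul_le_mul_of_nonneg_left hl2' (by positivity : 0 ≤ D₁ ^ 4 + 6 * D₁ ^ 2 * D₂ + 3 * D₂ ^ 2),
      mul_le_mul_of_nonneg_left hl2 (by positivity : 0 ≤ 4 * D₁ * D)]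
  intro j hj
  interval_cases j <;> simp only [if_true, if_false, show (1:ℕ) ≠ 0 by norm_num, show (2:ℕ) ≠ 0 by norm_num, show (2:ℕ) ≠ 1 by norm_num,
    show (3:ℕ) ≠ 0 by norm_num, show (3:ℕ) ≠ 1 by norm_num, show (3:ℕ) ≠ 2 by norm_num, show (4:ℕ) ≠ 0 by norm_num,
    show (4:ℕ) ≠ 1 by norm_num, show (4:ℕ) ≠ 2 by norm_num, show (4:ℕ) ≠ 3 by norm_num, pow_zero, mul_one, pow_one]
  · exact hP4
  · exact e1.trans (le_mul_of_one_le_right hP40 hl1)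
  · exact e2.trans (le_mul_of_one_le_right hP40 (one_le_pow₀ hl1))
  · exact e3.trans (mul_le_mul_of_nonneg_left (le_self_pow₀ hl1 (by norm_num)) hP40)
  · exact e4.trans (mul_le_mul_of_nonneg_left (pow_le_pow_right₀ hl1 (by norm_num)) hP40)

end Summit.HubbardSuperconductivity.HubbardSuperconductivity.Theorems.EngineV8

end
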